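import Literature.Computability.Cryptography.PeikertMachineH1
import HarnessLib

/-!
# The first component `h₁` of Peikert's `GapSVP → LWE` reduction against a solver of the SLACK-admissible `BDD` inputs

Topic `Computability/Cryptography` (family `pqc`), sequel of `PeikertMachineH1.lean` (`h1_gapSVP_to_bdd`:
the decider `M` of `GapSVP_{ζ,γ}`, `γ ≥ 2n/α`, from ANY randomised solver `R` of the `f`-admissible `BDD`
inputs `Peikert2009.SolvesBDD`). The inputs `((MB, x), r)` that `M` actually feeds to `R` satisfy MORE than
`Peikert2009.BDDAdmissible`: the machine's dyadic radius lies in `[A, 4A/3]` with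
`A = r₀(⌊√(2n)⌋+1)/√(2n) ≤ (9/8)r₀` for `n ≥ 32` (`r₀ = q√(2n)/(γ₀Md)`, `γ₀ = 2n/α`), so `(4/3)·r` is
still in Peikert's window `[r₀, 2r₀]` and the NO-case analysis (`no_case_scaled_unit`) applies at `(4/3)r`
too, giving the distance bound with a factor `3/4` to spare:

  `dist(x, L(MB)) ≤ (3/4) · αq/(√2 r)`.

This file records that slack as a weaker requirement on the solver — `Peikert2009.BDDAdmissibleS`
(`BDDAdmissible` AND the `3/4`-slack distance bound), `Peikert2009.SolvesBDDS` (success `≥ 1 - n^{-c}`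
asked only on slack-admissible inputs; implied by `SolvesBDD`, `SolvesBDD.solvesBDDS`) — and re-assembles
`h₁` and pqc.S20 against it: `rRat_window_S`, `prob_block_notok_le_of_no_S`, **`h1_gapSVP_to_bdd_S`**,
**`peikert_gapSVPZeta_to_lwe_classical_of_bddSolverS`** (pqc.S20 from an LWE-oracle solver of the
slack-admissible inputs alone). The proofs are those of `PeikertMachineAnalysis.prob_block_notok_le_of_no`
and `PeikertMachineH1.h1_gapSVP_to_bdd` with the one extra application of `no_case_scaled_unit`; the
dimension threshold moves from `3` to `32`.

Purpose: the second component (Regev's Lemma 3.4 with the GPV sampler, Peikert's Prop. 3.2) samples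
`D_{Λ*,r'}` at a width `r' ∈ [r, 8r/7]` of its own choosing (so that all Gaussian weights it computes are
`e^{-θ(j-c)²}` with RATIONAL `θ, c`, no digits of `π` needed); Regev's distance hypothesis
`r'·dist(x, Λ) ≤ α₀q` then needs exactly this slack.

All PROVED; two definitions with bodies (`BDDAdmissibleS`, `SolvesBDDS`); no named fact.

## References

* C. Peikert, *Public-key cryptosystems from the worst-case shortest vector problem*, STOC 2009, Thm. 3.1
  and its proof (full version Dagstuhl 08491 pp. 11–12) [Peikert2009].
* O. Regev, *On lattices, learning with errors, random linear codes, and cryptography*, J. ACM 56 (2009),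
  Lemma 3.4 (hypothesis `dist(x, L*) ≤ αp/(√2 r)`) [RegevLWE2009].
-/

noncomputable section

namespace Literature.Computability.Cryptography

namespace Peikert2009

open Filter Metric Literature.Algebra.EuclideanLattices Literature.Computability.Complexity
open scoped ENNReal

/-! ### Slack-admissible inputs and their solvers -/

/-- LOCAL GLUE. **Slack-admissible `BDD` inputs**: `f`-admissible in Peikert's sense (`BDDAdmissible`:
nonsingular, `r > 0`, `f(n)√(log n) ≤ r‖b̃ᵢ‖`, `√2·q·η_{2⁻ⁿ}(Λ*) ≤ r`, `dist(x, Λ) ≤ αq/(√2 r)`) AND the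
distance bound with a factor `3/4` to spare, `dist(x, Λ) ≤ (3/4)·αq/(√2 r)` — what the decider of
`h1_gapSVP_to_bdd` actually guarantees about its calls (`prob_block_notok_le_of_no_S`).
[cite: Peikert2009, Thm. 3.1 proof (NO case, full version p. 12); RegevLWE2009, Lemma 3.4] -/
def BDDAdmissibleS (q : ℕ → ℕ) (α f : ℕ → ℝ) (p : GapCVPInstance) : Prop :=
  BDDAdmissible q α f p ∧
    infDist p.1.targetE p.1.I.lattice ≤ 3 / 4 * (α p.1.I.n * q p.1.I.n / (Real.sqrt 2 * p.2))

/-- A slack-admissible input is admissible. [folklore] -/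
theorem BDDAdmissibleS.bddAdmissible {q : ℕ → ℕ} {α f : ℕ → ℝ} {p : GapCVPInstance}
    (h : BDDAdmissibleS q α f p) : BDDAdmissible q α f p := h.1

/-- LOCAL GLUE. **`R` (coins `coins`, rounds `fuel`) with oracle `O` solves the slack-admissible `BDD`
inputs**: as `SolvesBDD`, but the success bound `≥ 1 - n^{-c}` (every `c`, all large `n`) is asked only on
the inputs of `BDDAdmissibleS`. [cite: Peikert2009, Prop. 3.2; RegevLWE2009, Lemma 3.4] -/
def SolvesBDDS (q : ℕ → ℕ) (α f : ℕ → ℝ) (R : OracleAlg (List Bool)) (coins fuel : Polynomial ℕ)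
    (O : Oracle) : Prop :=
  ∀ c : ℕ, ∀ᶠ n : ℕ in atTop, ∀ p : GapCVPInstance, p.1.I.n = n → BDDAdmissibleS q α f p →
    ENNReal.ofReal (1 - 1 / (n : ℝ) ^ c) ≤ (R.randRun O coins fuel p.encode).toOuterMeasure (bddSuccess p)

/-- A solver of the admissible inputs solves the slack-admissible ones. [folklore] -/
theorem SolvesBDD.solvesBDDS {q : ℕ → ℕ} {α f : ℕ → ℝ} {R : OracleAlg (List Bool)} {coins fuel : Polynomial ℕ}
    {O : Oracle} (h : SolvesBDD q α f R coins fuel O) : SolvesBDDS q α f R coins fuel O :=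
  fun c => (h c).mono fun _ hn p hp hadm => hn p hp hadm.1

/-- `SolvesBDDS` is antitone in `f` (larger `f` = fewer admissible inputs). [folklore] -/
theorem SolvesBDDS.anti {q : ℕ → ℕ} {α f f' : ℕ → ℝ} (hff' : ∀ n, f n ≤ f' n) {R : OracleAlg (List Bool)}
    {coins fuel : Polynomial ℕ} {O : Oracle} (h : SolvesBDDS q α f R coins fuel O) :
    SolvesBDDS q α f' R coins fuel O :=
  fun c => (h c).mono fun _ hn p hp hadm => hn p hp ⟨hadm.1.anti hff', hadm.2⟩

namespace Spec

open _root_.Computability Literature.Algebra.EuclideanLattices Literature.Algebra.EuclideanLattices.GapCodes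
  Literature.Probability.Distributions Literature.Computability.Complexity Polynomial PMF Filter Asymptotics
  Literature.Computability.Complexity.CodeFP Literature.Computability.Cryptography.SIS.OddPartFP TTClosure
open scoped ENNReal

variable (coinsR fuelR : Polynomial ℕ) (R : OracleAlg (List Bool)) (O : Oracle) (ι : Inp)

/-! ### The machine's radius leaves room: `(4/3)·r ≤ 2r₀` from dimension `32` on -/

/-- **`(4/3)·r` is still in Peikert's window**: `(4/3)·r ≤ 2·q√(2n)/(γ₀ M d)` for `n ≥ 32` (`q ≥ 1`,
`a > 0`, `d ≥ 1`), because `r ≤ 4A/3` and `A = r₀(⌊√(2n)⌋+1)/√(2n) ≤ (9/8)·r₀` once `√(2n) ≥ 8`.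
[cite: Peikert2009, Thm. 3.1 proof] -/
theorem rRat_window_S {q : ℕ → ℕ} {α : ℕ → ℝ} (hn : 32 ≤ dim ι) (hqv : (qv ι : ℝ) = q (dim ι)) (hq1 : 1 ≤ q (dim ι))
    (hanum : 0 < anum ι) (haden : 0 < aden ι) (hαa : α (dim ι) = (anum ι : ℝ) / aden ι) (hd : (dden ι : ℤ) ≤ dnum ι) :
    (4 / 3 : ℝ) * rRat ι ≤
      2 * (q (dim ι) * Real.sqrt (2 * dim ι) / (2 * dim ι / α (dim ι) * ((scale (dim ι) : ℝ) * (ι.1.2 : ℝ)))) := by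
  have hn1 : 1 ≤ dim ι := by omega
  have hdenA := denA_pos ι hn1 haden hd
  have hqv1 : 1 ≤ qv ι := by
    have : (1 : ℝ) ≤ qv ι := by rw [hqv]; exact_mod_cast hq1
    exact_mod_cast this
  have hnumA := numA_pos ι hqv1 hanum.ne'
  have hA := A_eq ι hn1 haden hd hanum.le
  obtain ⟨hs1, hs2⟩ := sqrt_two_mul_window (dim ι)
  obtain ⟨Mr, hMr⟩ : ∃ Mr : ℝ, ((scale (dim ι) : ℕ) : ℝ) = Mr := ⟨_, rfl⟩
  have hMr0 : 0 < Mr := by rw [← hMr]; unfold scale; positivity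
  have hdpos := d_pos ι hd
  have hapos : 0 < α (dim ι) := by rw [hαa]; positivity
  have hqR : (1 : ℝ) ≤ q (dim ι) := by exact_mod_cast hq1
  set s := (Nat.sqrt (2 * dim ι) : ℝ) with hsdef
  have hs8 : (8 : ℝ) ≤ s := by
    have : 8 ≤ Nat.sqrt (2 * dim ι) := by rw [Nat.le_sqrt']; omega
    rw [hsdef]; exact_mod_cast this
  have hr0 : q (dim ι) * Real.sqrt (2 * dim ι) / (2 * dim ι / α (dim ι) * (Mr * (ι.1.2 : ℝ))) =
      (numA ι : ℝ) / denA ι * (Real.sqrt (2 * dim ι) / (s + 1)) := by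
    rw [hA, hMr, ← hqv, hαa]
    field_simp
  rw [hMr, hr0]
  have hApos : 0 < (numA ι : ℝ) / denA ι := by positivity
  -- `(4/3) r ≤ (16/9) A ≤ 2 A √(2n)/(s+1)` as `8(s+1) ≤ 9 s ≤ 9 √(2n)`
  have h43 := rRat_le_four_thirds ι hdenA hnumA
  have hfrac : 8 / 9 ≤ Real.sqrt (2 * dim ι) / (s + 1) := by
    rw [div_le_div_iff₀ (by norm_num) (by positivity)]; nlinarith
  nlinarith

/-! ### The NO bound for one block, against a solver of the slack-admissible inputs -/

/-- **On a NO instance one iteration misfires with probability at most `2^{n/2}e^{-2n} + n·8·2^{-m} + ε`**,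
where now `ε` bounds the solver's failure probability on the SLACK-admissible `BDD` inputs of dimension
`n` only (hypothesis `hS`, the dimension-`n` slice of `SolvesBDDS`); `γ ≥ γ₀ = 2n/α`, `n ≥ 32`. The machine's
call `((MB, x), r)` is slack-admissible: `no_case_scaled_unit` at `r` gives admissibility and the forced
answer, and at `(4/3)r ∈ [r₀, 2r₀]` (`rRat_window_S`) the distance bound `dist ≤ αq/(√2·(4/3)r)`.
[cite: Peikert2009, Thm. 3.1 proof (NO case)] -/
theorem prob_block_notok_le_of_no_S {q : ℕ → ℕ} {α f ζ γ : ℕ → ℝ} (hno : ι.1 ∈ GapSVPZeta.no ζ γ)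
    (hn : 32 ≤ dim ι) (hα : 0 < α (dim ι)) (hα1 : α (dim ι) < 1) (hf : 0 ≤ f (dim ι)) (hq1 : 1 ≤ q (dim ι))
    (hqv : (qv ι : ℝ) = q (dim ι)) (hanum : 0 < anum ι) (haden : 0 < aden ι) (hαa : α (dim ι) = (anum ι : ℝ) / aden ι)
    (hγ : 2 * dim ι / α (dim ι) ≤ γ (dim ι))
    (hq : ζ (dim ι) * f (dim ι) * Real.sqrt (Real.log (dim ι)) / Real.sqrt (dim ι) ≤ q (dim ι))
    {ε : ℝ} (hε0 : 0 ≤ ε) (hε1 : ε ≤ 1)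
    (hS : ∀ p' : GapCVPInstance, p'.1.I.n = dim ι → BDDAdmissibleS q α f p' →
      ENNReal.ofReal (1 - ε) ≤ (R.randRun O coinsR fuelR (GapCVPInstance.encode p')).toOuterMeasure (bddSuccess p')) :
    ((uniformOfFintype (List.Vector Bool (blockLen ι coinsR))).toOuterMeasure
        {blk | okBlk coinsR fuelR R O ι blk.toList = false}).toReal ≤
      (2 : ℝ) ^ ((dim ι : ℝ) / 2) * Real.exp (-(2 * dim ι)) + dim ι * (8 * ((2 : ℝ) ^ prec (dim ι))⁻¹) + ε := by
  classical
  have hn3 : 3 ≤ dim ι := le_trans (by norm_num) hn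
  obtain ⟨⟨hI, -, hGS, hd1, hdζ⟩, hfar⟩ := hno
  have hd : (dden ι : ℤ) ≤ dnum ι := by
    have h := hd1
    rw [d_eq_num_div_den ι, le_div_iff₀ (by exact_mod_cast ι.1.2.den_pos), one_mul] at h
    exact_mod_cast h
  have hn2 : 2 ≤ dim ι := by omega
  have hn1 : 1 ≤ dim ι := by omega
  set D := scaledD ι with hDdef
  set σ := sigma0 ι with hσdef
  have hDpos : 0 < D := by
    rw [hDdef]; unfold scaledD
    have h1 := d_pos ι hd
    have h2 : (0 : ℝ) < scale (dim ι) := by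
      have : 0 < scale (dim ι) := by unfold scale; positivity
      exact_mod_cast this
    exact mul_pos h2 h1
  -- the one-block probability in product form, as a sum over the perturbation
  rw [prob_block_okBlk_eq coinsR fuelR R O ι hI false, jointLaw, bind_map_prod_comm, toOuterMeasure_bind_apply]
  set big : Set (Fin (dim ι) → ℤ) := {w | D * Real.sqrt (dim ι) / 2 < ‖intVecToEuclidean (dim ι) w‖} with hbig
  set UT := uniformOfFintype (List.Vector Bool (tailLen ι coinsR)) with hUT
  -- KEY: for a short perturbation the solver's answer decodes to `x - w` except with probability `ε`
  have hkey : ∀ w, w ∉ big → (UT.map fun t => (t, w)).toOuterMeasure (okEvent coinsR fuelR R O ι false) ≤ ENNReal.ofReal ε := by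
    intro w hw
    have hw' : ‖intVecToEuclidean (dim ι) w‖ ≤ D * Real.sqrt (dim ι) / 2 := not_lt.1 hw
    -- the queried instance and its coins
    set p' := cvpOf ι w with hp'
    set u := GapCVPInstance.encode p' with hu
    set ℓ := coinsR.eval u.length with hℓ
    have hℓ' : ℓ ≤ tailLen ι coinsR := TM2Iter.eval_mono coinsR (length_encode_cvpOf_le_uBound ι hI w)
    -- admissibility and forced answer (`no_case_scaled_unit` at `γ₀ = 2n/α`), at `r` and at `(4/3) r`
    have hM0 : scale (dim ι) ≠ 0 := by unfold scale; positivity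
    obtain ⟨Mr, hMr⟩ : ∃ Mr : ℝ, ((scale (dim ι) : ℕ) : ℝ) = Mr := ⟨_, rfl⟩
    have hMr1 : 1 ≤ Mr := by rw [← hMr]; exact_mod_cast Nat.one_le_two_pow
    have hDM : D = Mr * (ι.1.2 : ℝ) := by rw [hDdef, scaledD, hMr]
    have hnpos : (0 : ℝ) < dim ι := by exact_mod_cast hn1
    have hγ0pos : 0 < 2 * (dim ι : ℝ) / α (dim ι) := div_pos (by linarith) hα
    obtain ⟨hr1, hr2⟩ := rRat_window ι (q := q) (α := α) hn2 hqv hq1 hanum haden hαa hd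
    have hr43 := rRat_window_S ι (q := q) (α := α) hn hqv hq1 hanum haden hαa hd
    have hnc : ∀ ρ : ℚ, q (dim ι) * Real.sqrt (2 * dim ι) / (2 * dim ι / α (dim ι) * ((scale (dim ι) : ℝ) * (ι.1.2 : ℝ))) ≤ ρ →
        (ρ : ℝ) ≤ 2 * (q (dim ι) * Real.sqrt (2 * dim ι) / (2 * dim ι / α (dim ι) * ((scale (dim ι) : ℝ) * (ι.1.2 : ℝ)))) →
        BDDAdmissible q α f (⟨J ι, Babai.intResidual (J ι).basis w⟩, ρ) ∧
          ∀ v, CVP.IsSolution (fun _ => 1) ⟨J ι, Babai.intResidual (J ι).basis w⟩ v → v = Babai.intResidual (J ι).basis w - w :=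
      fun ρ hρ1 hρ2 => no_case_scaled_unit (q := q) (α := α) (f := f) (ζ := ζ) (γ := fun k => 2 * k / α k) (J ι)
      (LatticeInstance.isNonsingular_scale hM0 hI) (M := Mr) (D := D) hMr1
      (by rw [hDM]; nlinarith [hd1])
      (fun i => by rw [← hMr, LatticeInstance.norm_gramSchmidt_scale hM0]; exact le_mul_of_one_le_right (Nat.cast_nonneg _) (hGS i))
      (by
        show 2 * ((J ι).n : ℝ) / α (J ι).n * D < minNorm (J ι).lattice
        rw [LatticeInstance.minNorm_scale_lattice hM0, hMr, hDM]
        have h1 : 2 * (dim ι : ℝ) / α (dim ι) * (ι.1.2 : ℝ) < minNorm ι.1.1.lattice :=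
          lt_of_le_of_lt (mul_le_mul_of_nonneg_right hγ (le_trans zero_le_one hd1)) hfar
        have := mul_lt_mul_of_pos_left h1 (lt_of_lt_of_le one_pos hMr1)
        calc 2 * ((J ι).n : ℝ) / α (J ι).n * (Mr * (ι.1.2 : ℝ)) = Mr * (2 * (dim ι : ℝ) / α (dim ι) * (ι.1.2 : ℝ)) := by
              show 2 * (dim ι : ℝ) / α (dim ι) * (Mr * (ι.1.2 : ℝ)) = _; ring
          _ < Mr * minNorm ι.1.1.lattice := this)
      (by
        show D ≤ Mr * ζ (J ι).n / (2 * ((J ι).n : ℝ) / α (J ι).n)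
        show D ≤ Mr * ζ (dim ι) / (2 * (dim ι : ℝ) / α (dim ι))
        rw [hDM, mul_div_assoc]
        refine mul_le_mul_of_nonneg_left (hdζ.trans ?_) (le_trans zero_le_one hMr1)
        have hζ0 : 0 ≤ ζ (dim ι) := by
          have : 0 ≤ ζ ι.1.1.n / γ ι.1.1.n := le_trans zero_le_one (hd1.trans hdζ)
          have hγpos : 0 < γ (dim ι) := lt_of_lt_of_le hγ0pos hγ
          have := mul_nonneg this hγpos.le
          rwa [div_mul_cancel₀ _ hγpos.ne'] at this
        exact div_le_div_of_nonneg_left hζ0 hγ0pos hγ)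
      hn3 hα hα1 hf hq1 (le_of_eq rfl) hq (Babai.intResidual (J ι).basis w) w (residual_sub_mem ι hI w)
      (by rwa [hDdef] at hw' ⊢) ρ
      (by rw [hDM, ← hMr]; exact hρ1) (by rw [hDM, ← hMr]; exact hρ2)
    obtain ⟨hadm, huniq⟩ := hnc (rRat ι) hr1 hr2
    have hrpos : (0 : ℝ) < rRat ι := by exact_mod_cast hadm.2.1
    -- the distance slack: admissibility at `(4/3)·r`
    have hr1' : q (dim ι) * Real.sqrt (2 * dim ι) / (2 * dim ι / α (dim ι) * ((scale (dim ι) : ℝ) * (ι.1.2 : ℝ))) ≤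
        ((4 / 3 * rRat ι : ℚ) : ℝ) := by
      push_cast; linarith
    have hr2' : (((4 / 3 * rRat ι : ℚ)) : ℝ) ≤
        2 * (q (dim ι) * Real.sqrt (2 * dim ι) / (2 * dim ι / α (dim ι) * ((scale (dim ι) : ℝ) * (ι.1.2 : ℝ)))) := by
      push_cast; exact hr43
    obtain ⟨⟨-, -, -, -, hdist43⟩, -⟩ := hnc (4 / 3 * rRat ι) hr1' hr2'
    have hadmS : BDDAdmissibleS q α f p' := by
      refine ⟨hadm, ?_⟩
      have h := hdist43
      have hs2 : (0 : ℝ) < Real.sqrt 2 := Real.sqrt_pos.2 two_pos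
      have hq0 : (0 : ℝ) < q (dim ι) := by exact_mod_cast (lt_of_lt_of_le zero_lt_one hq1)
      have heq : α (J ι).n * q (J ι).n / (Real.sqrt 2 * (((4 / 3 * rRat ι : ℚ)) : ℝ)) =
          3 / 4 * (α (J ι).n * q (J ι).n / (Real.sqrt 2 * (rRat ι : ℝ))) := by
        push_cast
        field_simp
      rw [heq] at h
      exact h
    -- the solver's guarantee on `p'`, over its own uniform coins of length `ℓ`
    have hSp := hS p' rfl hadmS
    -- rewrite our event as the preimage under `takeV ℓ` of the failure event over coins of length `ℓ`
    set G : Set (List.Vector Bool ℓ) := {c | decodeIntVec (dim ι) ((R.run O (fuelR.eval u.length) (boolPair u c.toList)).getD []) =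
      Babai.intResidual (J ι).basis w - w} with hG
    have hev : (fun t : List.Vector Bool (tailLen ι coinsR) => (t, w)) ⁻¹' okEvent coinsR fuelR R O ι false = takeV ℓ hℓ' ⁻¹' Gᶜ := by
      ext t
      simp only [Set.mem_preimage, okEvent, Set.mem_setOf_eq, okW, Set.mem_compl_iff, hG, takeV,
        OracleAlg.randAnswer_boolPair, decide_eq_false_iff_not, List.Vector.toList_mk]
      rfl
    rw [toOuterMeasure_map_apply, hev, ← toOuterMeasure_map_apply, uniform_map_takeV]
    -- `Pr[Gᶜ] = 1 - Pr[G] ≤ 1 - (1 - ε) = ε`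
    have hGge : ENNReal.ofReal (1 - ε) ≤ (uniformOfFintype (List.Vector Bool ℓ)).toOuterMeasure G := by
      refine hSp.trans ?_
      rw [OracleAlg.randRun, toOuterMeasure_map_apply]
      refine PMF.toOuterMeasure_mono _ fun c hc => ?_
      have hc' := hc.1
      simp only [Set.mem_preimage, bddSuccess, Set.mem_setOf_eq] at hc'
      exact huniq _ hc'
    have hsum := toOuterMeasure_compl_add (uniformOfFintype (List.Vector Bool ℓ)) G
    have hGc : (uniformOfFintype (List.Vector Bool ℓ)).toOuterMeasure Gᶜ = 1 - (uniformOfFintype (List.Vector Bool ℓ)).toOuterMeasure G :=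
      ENNReal.eq_sub_of_add_eq (ne_top_of_le_ne_top ENNReal.one_ne_top (hsum ▸ le_self_add)) (by rw [add_comm]; exact hsum)
    rw [hGc]
    calc 1 - (uniformOfFintype (List.Vector Bool ℓ)).toOuterMeasure G ≤ 1 - ENNReal.ofReal (1 - ε) := tsub_le_tsub_left hGge _
      _ = ENNReal.ofReal ε := by
          rw [← ENNReal.ofReal_one, ← ENNReal.ofReal_sub _ (by linarith)]
          congr 1; ring
  -- termwise bound and summation
  have hle1 : ∀ {X : Type} (p : PMF X) (s : Set X), p.toOuterMeasure s ≤ 1 := fun p s =>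
    le_of_le_of_eq le_self_add (toOuterMeasure_compl_add p s)
  have hterm : ∀ w, nu ι w * (UT.map fun t => (t, w)).toOuterMeasure (okEvent coinsR fuelR R O ι false) ≤
      nu ι w * big.indicator 1 w + nu ι w * ENNReal.ofReal ε := fun w => by
    by_cases hw : w ∈ big
    · rw [Set.indicator_of_mem hw, Pi.one_apply, mul_one]
      exact le_add_right (mul_le_of_le_one_right bot_le (hle1 _ _))
    · rw [Set.indicator_of_notMem hw, mul_zero, zero_add]
      exact mul_le_mul' le_rfl (hkey w hw)
  have hle : (∑' w, nu ι w * (UT.map fun t => (t, w)).toOuterMeasure (okEvent coinsR fuelR R O ι false)) ≤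
      (nu ι).toOuterMeasure big + ENNReal.ofReal ε := by
    refine (ENNReal.tsum_le_tsum hterm).trans ?_
    rw [ENNReal.tsum_add, ENNReal.tsum_mul_right, (nu ι).tsum_coe, one_mul, toOuterMeasure_apply]
    refine add_le_add (le_of_eq (tsum_congr fun w => ?_)) le_rfl
    by_cases hw : w ∈ big
    · rw [Set.indicator_of_mem hw, Set.indicator_of_mem hw, Pi.one_apply, mul_one]
    · rw [Set.indicator_of_notMem hw, Set.indicator_of_notMem hw, mul_zero]
  -- pass to reals
  have hbig_ne : (nu ι).toOuterMeasure big ≠ ∞ := ne_top_of_le_ne_top ENNReal.one_ne_top (hle1 _ _)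
  have hR : (∑' w, nu ι w * (UT.map fun t => (t, w)).toOuterMeasure (okEvent coinsR fuelR R O ι false)).toReal ≤
      ((nu ι).toOuterMeasure big).toReal + ε := by
    have h := ENNReal.toReal_mono (ENNReal.add_ne_top.2 ⟨hbig_ne, ENNReal.ofReal_ne_top⟩) hle
    rwa [ENNReal.toReal_add hbig_ne ENNReal.ofReal_ne_top, ENNReal.toReal_ofReal hε0] at h
  -- the tail of the perturbation: rounded Gaussian tail + statistical error
  have hbigR : ((nu ι).toOuterMeasure big).toReal ≤ (2 : ℝ) ^ ((dim ι : ℝ) / 2) * Real.exp (-(2 * dim ι)) + dim ι * (8 * ((2 : ℝ) ^ prec (dim ι))⁻¹) := by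
    have htv := abs_sub_le_iff.1 ((abs_toReal_toOuterMeasure_sub_le_tvDist (nu ι) (roundedGaussian (dim ι) σ) big).trans
      (tvDist_nu_roundedGaussian_le ι hd))
    have htail : ((roundedGaussian (dim ι) σ).toOuterMeasure big).toReal ≤ (2 : ℝ) ^ ((dim ι : ℝ) / 2) * Real.exp (-(2 * dim ι)) := by
      refine roundedGaussian_norm_tail_le hn2 (half_le_sigma0 ι) ?_
      have h8 : σ ≤ D / 8 := sigma0_le_scaledD_div_eight ι hd
      have hsq : 0 ≤ Real.sqrt (dim ι) := Real.sqrt_nonneg _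
      have := mul_le_mul_of_nonneg_right h8 hsq
      linarith
    linarith [htv.1]
  linarith

/-! ### The theorem, against a solver of the slack-admissible inputs -/

variable {q : ℕ → ℕ} {a : ℕ → ℚ}

/-- **The first component of Peikert's reduction from a solver of the SLACK-admissible inputs (`h₁`,
regime `γ ≥ 2n/α`).** As `h1_gapSVP_to_bdd`, with the hypothesis on the oracle weakened from `SolvesBDD` to
`SolvesBDDS`: the same machine `M` decides `GapSVP_{ζ,γ}` with error `≤ 1/3` on all instances of every
large enough dimension. [cite: Peikert2009, Thm. 3.1 (proof)] -/
theorem h1_gapSVP_to_bdd_S {α : ℕ → ℝ} {m : ℕ → ℕ}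
    (hpar : IsPolyTimeParams q α m) (hαev : ∀ᶠ n : ℕ in atTop, 0 < α n ∧ α n < 1) (γ ζ f : ℕ → ℝ)
    (hf : Tendsto f atTop atTop)
    (hbounds : ∀ᶠ n : ℕ in atTop, 2 * n / α n ≤ γ n ∧ γ n ≤ ζ n ∧ ζ n * f n * Real.sqrt (Real.log n) / Real.sqrt n ≤ q n)
    (R : OracleAlg (List Bool)) (coinsR fuelR : Polynomial ℕ) (hR : R.IsPolyTime (encodingList Bool)) :
    ∃ (M : OracleAlg Bool) (coins fuel : Polynomial ℕ), M.IsPolyTime encodingBoolBool ∧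
      ∀ O : Oracle, SolvesBDDS q α f R coinsR fuelR O →
        ∀ᶠ n in atTop, ∀ p : GapSVPInstance, p.1.n = n →
          (p ∈ GapSVPZeta.yes ζ γ → 2 / 3 ≤ M.randRun O coins fuel p.encode (some true)) ∧
          (p ∈ GapSVPZeta.no ζ γ → 2 / 3 ≤ M.randRun O coins fuel p.encode (some false)) := by
  classical
  obtain ⟨hqpt, -, a, hαa, hapt⟩ := hpar
  obtain ⟨Q, hQ, hQe⟩ := exists_query_mem_FP coinsR hqpt hapt
  obtain ⟨D, hD, hDe⟩ := exists_verdict_mem_P coinsR hqpt hapt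
  obtain ⟨C, hC, qC, hCrun⟩ := exists_polyTime_ttRandDecider hQ hD (Polynomial.C iters) hR fuelR []
  -- coins: enough for `N₀` blocks (`blockLen` is polynomially bounded: it is computed in unary in `FP`)
  obtain ⟨F, hF, hFe⟩ := ((blockLenUn_codeFP coinsR).comp (mkInp_codeFP hqpt hapt) : CodeFP GapSVPInstance.encode unE _)
  obtain ⟨Pol, hPol⟩ := exists_poly_length_le_of_mem_FP hF
  have hblock : ∀ p : GapSVPInstance, blockLen (mkInp q a p) coinsR ≤ Pol.eval p.encode.length := fun p => by
    have h := hPol p.encode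
    rw [hFe p] at h
    simpa only [length_unE] using h
  set coins : Polynomial ℕ := Polynomial.C iters * Pol with hcoins
  set fuel : Polynomial ℕ := qC.comp (2 * X + 2 + coins) with hfuel
  refine ⟨C, coins, fuel, hC, fun O hO => ?_⟩
  filter_upwards [hαev, hbounds, hf.eventually_ge_atTop 1, eventually_ge_atTop 32, hO 1, eventually_noErr_le] with
    n hαn hbn hfn hn32 hSn hnoErr p hpn
  subst hpn
  have hn3 : 3 ≤ p.1.n := le_trans (by norm_num) hn32
  set ι : Inp := mkInp q a p with hι
  -- the run on coins `r`
  have hlen : ∀ r : List.Vector Bool (coins.eval p.encode.length),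
      (boolPair p.encode r.toList).length = (2 * X + 2 + coins).eval p.encode.length := fun r => by
    rw [length_boolPair, List.Vector.toList_length]; simp
  have hrun : ∀ r : List.Vector Bool (coins.eval p.encode.length),
      C.run O (fuel.eval p.encode.length) (boolPair p.encode r.toList) =
        some (decide ((dden ι : ℤ) ≤ dnum ι) && (List.range iters).any fun j =>
          !okBlk coinsR fuelR R O ι (block ι coinsR r.toList j)) := fun r => by
    have h := hCrun O (boolPair p.encode r.toList)
    rw [hlen r] at h
    rw [hfuel, eval_comp, h, ttDecL, eval_C, ttQueries_eq coinsR hQe, List.map_map]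
    congr 1
    rw [show ((fun j => query (mkInp q a p) coinsR r.toList j) : ℕ → List Bool) = fun j => query ι coinsR r.toList j from rfl]
    have hmap : (List.range iters).map (OracleAlg.randAnswer R fuelR [] O ∘ fun j => query ι coinsR r.toList j) =
        (List.range iters).map fun j => OracleAlg.randAnswer R fuelR [] O (query ι coinsR r.toList j) := rfl
    rw [hmap, hDe p r.toList, ← hι, verdict_run]
  have hprob : ∀ b : Bool, C.randRun O coins fuel p.encode (some b) =
      (uniformOfFintype (List.Vector Bool (coins.eval p.encode.length))).toOuterMeasure
        {r | (decide ((dden ι : ℤ) ≤ dnum ι) && (List.range iters).any fun j =>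
          !okBlk coinsR fuelR R O ι (block ι coinsR r.toList j)) = b} := fun b => by
    rw [OracleAlg.randRun, ← toOuterMeasure_apply_singleton, toOuterMeasure_map_apply]
    congr 1
    ext r
    simp only [Set.mem_preimage, Set.mem_singleton_iff, hrun r, Option.some.injEq, Set.mem_setOf_eq]
  have hcoinsN : blockLen ι coinsR * iters ≤ coins.eval p.encode.length := by
    rw [hcoins, eval_mul, eval_C, mul_comm]
    exact Nat.mul_le_mul_left _ (hblock p)
  -- shared facts about the parameters at this dimension
  have hn1 : 1 ≤ dim ι := le_trans (by norm_num) hn3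
  have hα0 : 0 < α (dim ι) := hαn.1
  have ha0 : 0 < a (dim ι) := by have := hαa (dim ι); rw [this] at hα0; exact_mod_cast hα0
  have hanum : 0 < anum ι := Rat.num_pos.2 ha0
  have haden : 0 < aden ι := (a (dim ι)).den_pos
  have hαa' : α (dim ι) = (anum ι : ℝ) / aden ι := by rw [hαa]; exact Rat.cast_def _
  have hqv : (qv ι : ℝ) = q (dim ι) := rfl
  -- the two "every iteration is fine" events coincide
  set Sok : Set (List Bool) := {blk | okBlk coinsR fuelR R O ι blk = true} with hSok
  have hall : ∀ r : List.Vector Bool (coins.eval p.encode.length),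
      ((List.range iters).any fun j => !okBlk coinsR fuelR R O ι (block ι coinsR r.toList j)) = false ↔
        ∀ j < iters, block ι coinsR r.toList j ∈ Sok := fun r => by
    rw [List.any_eq_false]
    simp only [List.mem_range, Bool.not_eq_true', Bool.not_eq_false, hSok, Set.mem_setOf_eq]
  constructor
  · -- YES: accept unless every iteration is fooled; each is fooled w.p. `≤ 1 - hA/2`, independently
    intro hyes
    have hd1 : (1 : ℝ) ≤ ι.1.2 := hyes.1.2.2.2.1
    have hd : decide ((dden ι : ℤ) ≤ dnum ι) = true := by
      rw [decide_eq_true_eq]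
      have h := hd1
      rw [d_eq_num_div_den ι, le_div_iff₀ (by exact_mod_cast ι.1.2.den_pos), one_mul] at h
      exact_mod_cast h
    rw [hprob true]
    set U := uniformOfFintype (List.Vector Bool (coins.eval p.encode.length)) with hU
    have hset : {r : List.Vector Bool (coins.eval p.encode.length) |
        (decide ((dden ι : ℤ) ≤ dnum ι) && (List.range iters).any fun j => !okBlk coinsR fuelR R O ι (block ι coinsR r.toList j)) = true} =
        {r | ∀ j < iters, block ι coinsR r.toList j ∈ Sok}ᶜ := by
      ext r
      simp only [hd, Bool.true_and, Set.mem_setOf_eq, Set.mem_compl_iff]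
      rw [← hall r, Bool.not_eq_false]
    rw [hset]
    have hforall := prob_coins_forall_mem coinsR ι hcoinsN Sok
    have hθ : ((uniformOfFintype (List.Vector Bool (blockLen ι coinsR))).toOuterMeasure {b | b.toList ∈ Sok}).toReal ≤ 1 - hidingAdvantage / 2 := by
      have h := prob_block_ok_le_of_yes coinsR fuelR R O ι hyes hn1
      have := tvErr_le_half_hidingAdvantage (dim ι)
      simpa [hSok] using (by linarith : ((uniformOfFintype (List.Vector Bool (blockLen ι coinsR))).toOuterMeasure
        {blk | okBlk coinsR fuelR R O ι blk.toList = true}).toReal ≤ 1 - hidingAdvantage / 2)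
    have hpow : (U.toOuterMeasure {r | ∀ j < iters, block ι coinsR r.toList j ∈ Sok}).toReal ≤ 1 / 3 := by
      rw [hU, hforall, ENNReal.toReal_pow]
      exact (pow_le_pow_left₀ ENNReal.toReal_nonneg hθ _).trans pow_iters_le_third
    have hcompl := toReal_toOuterMeasure_compl U {r | ∀ j < iters, block ι coinsR r.toList j ∈ Sok}
    have hne : U.toOuterMeasure {r | ∀ j < iters, block ι coinsR r.toList j ∈ Sok}ᶜ ≠ ∞ :=
      ne_top_of_le_ne_top ENNReal.one_ne_top (le_of_le_of_eq le_add_self (toOuterMeasure_compl_add U _))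
    rw [two_thirds_ennreal, ENNReal.ofReal_le_iff_le_toReal hne, hcompl]
    linarith
  · -- NO: reject unless some iteration misfires; union bound over the `N₀` iterations
    intro hno
    have hd1 : (1 : ℝ) ≤ ι.1.2 := hno.1.2.2.2.1
    have hd : decide ((dden ι : ℤ) ≤ dnum ι) = true := by
      rw [decide_eq_true_eq]
      have h := hd1
      rw [d_eq_num_div_den ι, le_div_iff₀ (by exact_mod_cast ι.1.2.den_pos), one_mul] at h
      exact_mod_cast h
    rw [hprob false]
    set U := uniformOfFintype (List.Vector Bool (coins.eval p.encode.length)) with hU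
    set Sbad : Set (List Bool) := {blk | okBlk coinsR fuelR R O ι blk = false} with hSbad
    have hset : {r : List.Vector Bool (coins.eval p.encode.length) |
        (decide ((dden ι : ℤ) ≤ dnum ι) && (List.range iters).any fun j => !okBlk coinsR fuelR R O ι (block ι coinsR r.toList j)) = false} =
        {r | ∃ j < iters, block ι coinsR r.toList j ∈ Sbad}ᶜ := by
      ext r
      simp only [hd, Bool.true_and, Set.mem_setOf_eq, Set.mem_compl_iff, hall r, hSok, hSbad, not_exists, not_and,
        Bool.not_eq_false]
    rw [hset]
    -- the modulus is at least `1` and `f ≥ 0` at this dimension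
    have hf0 : 0 ≤ f (dim ι) := le_trans zero_le_one hfn
    have hq1 : 1 ≤ q (dim ι) := by
      obtain ⟨hγ, hγζ, hq⟩ : 2 * (dim ι : ℝ) / α (dim ι) ≤ γ (dim ι) ∧ γ (dim ι) ≤ ζ (dim ι) ∧
          ζ (dim ι) * f (dim ι) * Real.sqrt (Real.log (dim ι)) / Real.sqrt (dim ι) ≤ q (dim ι) := hbn
      have hL := one_le_sqrt_log hn3
      have hnR : (3 : ℝ) ≤ dim ι := by exact_mod_cast hn3
      have hs : 0 < Real.sqrt (dim ι) := Real.sqrt_pos.2 (by linarith)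
      have hs' : Real.sqrt (dim ι) ≤ dim ι := by
        rw [Real.sqrt_le_left (by linarith)]; nlinarith
      have hα1 : α (dim ι) < 1 := hαn.2
      have hγpos : (2 : ℝ) * dim ι ≤ γ (dim ι) := by
        refine le_trans ?_ hγ
        rw [le_div_iff₀ hα0]
        have := mul_le_mul_of_nonneg_left hα1.le (show (0 : ℝ) ≤ 2 * (dim ι : ℝ) by positivity)
        linarith
      have hchain : (2 : ℝ) * dim ι * 1 * 1 / Real.sqrt (dim ι) ≤ q (dim ι) := by
        refine le_trans ?_ hq
        rw [div_le_div_iff_of_pos_right hs]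
        have hζ : 2 * (dim ι : ℝ) ≤ ζ (dim ι) := hγpos.trans hγζ
        exact mul_le_mul (mul_le_mul hζ hfn zero_le_one (by linarith)) hL zero_le_one (by nlinarith)
      have : (1 : ℝ) ≤ q (dim ι) := by
        refine le_trans ?_ hchain
        rw [le_div_iff₀ hs]; nlinarith
      exact_mod_cast this
    have hexists := prob_coins_exists_mem_le coinsR ι hcoinsN Sbad
    have hbad : ((uniformOfFintype (List.Vector Bool (blockLen ι coinsR))).toOuterMeasure {b | b.toList ∈ Sbad}).toReal ≤
        (2 : ℝ) ^ ((dim ι : ℝ) / 2) * Real.exp (-(2 * dim ι)) + dim ι * (8 * ((2 : ℝ) ^ prec (dim ι))⁻¹) + 1 / (dim ι : ℝ) ^ (1 : ℕ) := by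
      have h := prob_block_notok_le_of_no_S coinsR fuelR R O ι hno hn32 hα0 hαn.2 hf0 hq1 hqv hanum haden hαa' hbn.1 hbn.2.2
        (ε := 1 / (dim ι : ℝ) ^ (1 : ℕ)) (by positivity) (by
          rw [pow_one, div_le_one (by exact_mod_cast (lt_of_lt_of_le zero_lt_one hn1))]; exact_mod_cast hn1)
        (fun p' hp' hadm => hSn p' hp' hadm)
      simpa [hSbad] using h
    have hne1 : (uniformOfFintype (List.Vector Bool (blockLen ι coinsR))).toOuterMeasure {b | b.toList ∈ Sbad} ≠ ∞ :=
      ne_top_of_le_ne_top ENNReal.one_ne_top (le_of_le_of_eq le_self_add (toOuterMeasure_compl_add _ _))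
    have hunion : (U.toOuterMeasure {r | ∃ j < iters, block ι coinsR r.toList j ∈ Sbad}).toReal ≤ 1 / 3 := by
      have h := ENNReal.toReal_mono (ENNReal.mul_ne_top (ENNReal.natCast_ne_top iters) hne1) hexists
      rw [ENNReal.toReal_mul, ENNReal.toReal_natCast] at h
      exact h.trans ((mul_le_mul_of_nonneg_left hbad (Nat.cast_nonneg _)).trans hnoErr)
    have hcompl := toReal_toOuterMeasure_compl U {r | ∃ j < iters, block ι coinsR r.toList j ∈ Sbad}
    have hne : U.toOuterMeasure {r | ∃ j < iters, block ι coinsR r.toList j ∈ Sbad}ᶜ ≠ ∞ :=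
      ne_top_of_le_ne_top ENNReal.one_ne_top (le_of_le_of_eq le_add_self (toOuterMeasure_compl_add U _))
    rw [two_thirds_ennreal, ENNReal.ofReal_le_iff_le_toReal hne, hcompl]
    linarith

end Spec

end Peikert2009

/-! ### pqc.S20 from an LWE-oracle solver of the slack-admissible inputs -/

section Assembly

open Filter Topology Asymptotics _root_.Computability Literature.Algebra.EuclideanLattices Literature.Computability.Complexity
  Literature.Computability.Cryptography.LWE

variable (q : ℕ → ℕ) [∀ n, NeZero (q n)] (α : ℕ → ℝ) (m : ℕ → ℕ)

/-- **pqc.S20 reduced to a solver of the slack-admissible inputs.** The named fact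
`peikert_gapSVPZeta_to_lwe_classical q α m` follows from the second component in the WEAKER form
`h₂ˢ`: for every growth witness `f → ∞`, ONE polynomial-time randomised oracle algorithm `R` that, for every
oracle solving search-`LWE_{q,Ψ̄_α}` from `m` samples (average case, probability `≥ 2/3`), solves the
SLACK-admissible `BDD` inputs (`Peikert2009.SolvesBDDS`). (`peikert_gapSVPZeta_to_lwe_classical_of_components'`
with `Spec.h1_gapSVP_to_bdd_S` in place of `h₁`: the first component only ever calls `R` on slack-admissible
inputs.) [cite: Peikert2009, Thm. 3.1 (proof: Prop. 3.2 with Regev's Lemma 3.4)] -/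
theorem peikert_gapSVPZeta_to_lwe_classical_of_bddSolverS
    (h₂ : ∀ (_ : IsPolyTimeParams q α m) (_ : IsPolyBounded m) (_ : ∀ᶠ n : ℕ in atTop, 2 ≤ q n)
      (_ : ∀ᶠ n : ℕ in atTop, 0 < α n ∧ α n < 1) (f : ℕ → ℝ), Tendsto f atTop atTop →
      ∃ (R : OracleAlg (List Bool)) (coins fuel : Polynomial ℕ), R.IsPolyTime (encodingList Bool) ∧
        ∀ O : Oracle, O.SolvesSearchLWE q (fun n => discretizedGaussian (q n) (α n)) m (2 / 3) →
          Peikert2009.SolvesBDDS q α f R coins fuel O) :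
    peikert_gapSVPZeta_to_lwe_classical q α m := by
  intro hpar hm hα
  refine ⟨peikertGamma' α, one_le_peikertGamma' α, isSoftBigO_peikertGamma' α hα, ?_⟩
  intro ζ f hf hζ
  have hq2 : ∀ᶠ n : ℕ in atTop, 2 ≤ q n := eventually_two_le_modulus' q α hα hf hζ
  obtain ⟨R, coinsR, fuelR, hRpoly, hR⟩ := h₂ hpar hm hq2 hα f hf
  have hbounds : ∀ᶠ n : ℕ in atTop, 2 * n / α n ≤ peikertGamma' α n ∧
      peikertGamma' α n ≤ ζ n ∧ ζ n * f n * Real.sqrt (Real.log n) / Real.sqrt n ≤ q n :=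
    hζ.mono fun n hn => ⟨le_peikertGamma' α n, hn.1, hn.2⟩
  obtain ⟨M, coins, fuel, hMpoly, hM⟩ :=
    Peikert2009.Spec.h1_gapSVP_to_bdd_S hpar hα (peikertGamma' α) ζ f hf hbounds R coinsR fuelR hRpoly
  exact ⟨M, coins, fuel, hMpoly, fun O hO => hM O (hR O hO)⟩

end Assembly

end Literature.Computability.Cryptography

end
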